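import Summits.CriticalPhenomena.PercolationContinuityZ3.Theorems.PercNearOneGluingNoHeavyQuantDIBStarFloorSplitInductionCore
import Summits.CriticalPhenomena.PercolationContinuityZ3.Theorems.PercNearOneGluingNoHeavyQuantIndepBlobGranular
import Summits.CriticalPhenomena.PercolationContinuityZ3.Theorems.PercNearOneGluingNoHeavyQuantIndepBlobTwoLightDIBStar
import HarnessLib

/-!
# QUANT lane R8, Conjecture DIB\* — the floor-split step lemma narrowed to the LUMPY CORE (lead g18): at least THREE non-empty lights,
# the largest blob bigger than `j/(2x)` and of gate `< 1`, empty blobs sure; `StepLemmaFSLumpy ↔ ∀ x < 1, DIBStar x`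

builds on p205010 (kernel theorem, internal audit signed; external expert review pending)

Statement + support file (`--supports stmt-CriticalPhenomena-4575`), QUANT lane lead (gen 18); memo
`run/shared/lean/prim/quant/prim-quant-lead-g18/LEAD-NOTES-G18.md` N35.  ONE `Prop` definition (the `@[conjecture]` `StepLemmaFSLumpy`), theorems
otherwise; no sorries, standard axioms.

After `…FloorSplitInductionCore` (lead g18, p264327: no dead light, light total `≥ j+1`, largest blob not sure) two more kernel families
leave the hard class: **two lights** (p1 g12, p264263 `IndepBlob.dibStar_of_twoLights`: exactly two light blobs, every other blob heavy) and
**granular systems** (lead g18, p265244 `IndepBlob.tail_ge_of_granular`: every size `≤ j/(2x)`, any floor).  This file re-runs the floor-split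
induction once more and hands both to the step, after normalising EMPTY blobs to gate `1` (an empty blob is inert:
`RootDec.term_update_gate_of_size_zero`), so that 'every other blob heavy' can be met:

* `Quant.RootDec.term_update_gate_of_size_zero`, `term_congr_offEmpty`, `dibSum_congr_offEmpty` — the TERM tail does not depend on the gates of empty blobs.
* `Quant.IndepBlob.StepLemmaFSLumpy` (`@[conjecture]`) — `StepLemmaFSCore` with: empty blobs SURE (`a k = 0 → g k = 1`), at least THREE
  pairwise distinct non-empty light blobs, and NOT granular (`∃ k, j < 2x·a k`: the largest blob exceeds `j/(2x) ≥ j/2`).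
* **`Quant.RootDec.cappedRows_of_stepLemmaFSLumpy`**, **`Quant.IndepBlob.stepLemmaFSLumpy_iff_dibStar : StepLemmaFSLumpy ↔ ∀ x < 1, DIBStar x`.**

So the OPEN CLASS of T-DIB after gen 18 is exactly the LUMPY CORE: `1/2 < x < 1`; sizes `≤ j`; heavy total `≤ 2j`; empty blobs sure; at least
three non-empty lights, each with `x² < g < x`, light total `≥ j+1`; credit `> 2j`; the largest blob has size `> j/(2x)` and gate `< 1` — given
the capped rows of every one-blob deletion.  Evidence: 8.77 M exact hard instances / 0 for the single split on the largest blob; minimal complete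
closed-form menu open ∈ {∨, ε} × closed ∈ {∧, ε}, adversarial margin ≥ 0.11(1−x) (README V216/V217/V217′).  [this work]; the gluing rows served
[cite: KozmaNitzan2024, Conjecture 3 (p. 15)].
-/

namespace Summit.CriticalPhenomena.PercolationContinuityZ3.Theorems

namespace Quant

namespace RootDec

open Finset

variable {κ : Type*} [Fintype κ] [DecidableEq κ]

/-- product-Bernoulli weight of the set `W` of open blobs (as in `…QuantRootReduction`) -/
local notation3 "wt[" g ", " W "]" => ∏ k, (if k ∈ (W : Finset κ) then (g : κ → ℝ) k else 1 - (g : κ → ℝ) k)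

/-- the TERM tail `P(s + Σ_{k open} a k ≥ j+1)` (as in `…QuantRootReduction`) -/
local notation3 "TERM[" s ", " a ", " g ", " j "]" =>
  ∑ W : Finset κ, wt[g, W] * (if (j : ℕ) + 1 ≤ (s : ℕ) + ∑ k ∈ W, (a : κ → ℕ) k then (1 : ℝ) else 0)

/-! ### 1. Empty blobs are inert -/

/-- **The gate of an EMPTY blob is irrelevant**: if `a k = 0` then `TERM[s, a, g[k ↦ c], j] = TERM[s, a, g, j]` for every `c`.
(Pair `W ∌ k` with `insert k W`: the two weights add up to the weight of `W` in the system without `k`, and the two indicators agree.)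
[this work] -/
theorem term_update_gate_of_size_zero (s : ℕ) (a : κ → ℕ) (g : κ → ℝ) (j : ℕ) (k : κ) (hk : a k = 0) (c : ℝ) :
    TERM[s, a, Function.update g k c, j] = TERM[s, a, g, j] := by
  -- both sides equal the `k`-free sum
  have hpow : ∀ (F : Finset κ → ℝ), ∑ W : Finset κ, F W =
      ∑ W ∈ (Finset.univ.erase k).powerset, F W + ∑ W ∈ (Finset.univ.erase k).powerset, F (insert k W) := by
    intro F
    rw [← Finset.sum_powerset_insert (Finset.notMem_erase k Finset.univ), Finset.insert_erase (Finset.mem_univ k),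
      Finset.powerset_univ]
  have reduce : ∀ (g' : κ → ℝ), TERM[s, a, g', j] =
      ∑ W ∈ (Finset.univ.erase k).powerset, (∏ i ∈ Finset.univ.erase k, (if i ∈ W then g' i else 1 - g' i)) *
        (if j + 1 ≤ s + ∑ i ∈ W, a i then (1 : ℝ) else 0) := by
    intro g'
    rw [hpow, ← Finset.sum_add_distrib]
    refine Finset.sum_congr rfl fun W hW => ?_
    have hkW : k ∉ W := fun h => Finset.notMem_erase k Finset.univ (Finset.mem_powerset.1 hW h)
    have hw1 : (∏ i, (if i ∈ W then g' i else 1 - g' i)) =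
        (1 - g' k) * ∏ i ∈ Finset.univ.erase k, (if i ∈ W then g' i else 1 - g' i) := by
      rw [← Finset.mul_prod_erase Finset.univ (fun i => if i ∈ W then g' i else 1 - g' i) (Finset.mem_univ k), if_neg hkW]
    have hw2 : (∏ i, (if i ∈ insert k W then g' i else 1 - g' i)) =
        g' k * ∏ i ∈ Finset.univ.erase k, (if i ∈ W then g' i else 1 - g' i) := by
      rw [← Finset.mul_prod_erase Finset.univ (fun i => if i ∈ insert k W then g' i else 1 - g' i) (Finset.mem_univ k),
        if_pos (Finset.mem_insert_self k W)]
      congr 1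
      refine Finset.prod_congr rfl fun i hi => ?_
      have hik : i ≠ k := Finset.ne_of_mem_erase hi
      simp only [Finset.mem_insert, hik, false_or]
    have hm : ∑ i ∈ insert k W, a i = ∑ i ∈ W, a i := by rw [Finset.sum_insert hkW, hk, zero_add]
    rw [hw1, hw2, hm]
    ring
  rw [reduce (Function.update g k c), reduce g]
  refine Finset.sum_congr rfl fun W _ => ?_
  congr 1
  exact Finset.prod_congr rfl fun i hi => by rw [Function.update_of_ne (Finset.ne_of_mem_erase hi)]

/-- **Gates of empty blobs are irrelevant**: if `g'` agrees with `g` on every non-empty blob then `TERM[s, a, g', j] = TERM[s, a, g, j]`.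
[this work] -/
theorem term_congr_offEmpty (s : ℕ) (a : κ → ℕ) (g g' : κ → ℝ) (j : ℕ) (h : ∀ k, a k ≠ 0 → g' k = g k) :
    TERM[s, a, g', j] = TERM[s, a, g, j] := by
  -- induction over a finset `E` outside which `g' = g`; inside, blobs are empty
  suffices main : ∀ (E : Finset κ) (g₁ : κ → ℝ), (∀ k, k ∉ E → g₁ k = g k) → (∀ k ∈ E, a k = 0) →
      TERM[s, a, g₁, j] = TERM[s, a, g, j] by
    refine main (Finset.univ.filter fun k => a k = 0) g' (fun k hk => h k ?_) (fun k hk => (Finset.mem_filter.1 hk).2)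
    intro h0
    exact hk (Finset.mem_filter.2 ⟨Finset.mem_univ k, h0⟩)
  intro E
  induction E using Finset.induction_on with
  | empty =>
    intro g₁ hg₁ _
    have e : g₁ = g := funext fun k => hg₁ k (Finset.notMem_empty k)
    rw [e]
  | @insert k E hkE ih =>
    intro g₁ hg₁ hE
    have hk : a k = 0 := hE k (Finset.mem_insert_self k E)
    -- move the gate of `k` back to `g k`, then apply the induction hypothesis
    have h1 : TERM[s, a, Function.update g₁ k (g k), j] = TERM[s, a, g₁, j] := term_update_gate_of_size_zero s a g₁ j k hk (g k)
    have h2 : TERM[s, a, Function.update g₁ k (g k), j] = TERM[s, a, g, j] := by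
      refine ih (Function.update g₁ k (g k)) (fun i hi => ?_) (fun i hi => hE i (Finset.mem_insert_of_mem hi))
      by_cases hik : i = k
      · subst hik; simp
      · rw [Function.update_of_ne hik]
        exact hg₁ i (by simp [Finset.mem_insert, hik, hi])
    rw [← h1, h2]

/-- The same for the DIB\*-sum (no sure part). [this work] -/
theorem dibSum_congr_offEmpty (a : κ → ℕ) (g g' : κ → ℝ) (j : ℕ) (h : ∀ k, a k ≠ 0 → g' k = g k) :
    ∑ W : Finset κ, wt[g', W] * (if j + 1 ≤ ∑ k ∈ W, a k then (1 : ℝ) else 0) =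
      ∑ W : Finset κ, wt[g, W] * (if j + 1 ≤ ∑ k ∈ W, a k then (1 : ℝ) else 0) := by
  have e := term_congr_offEmpty 0 a g g' j h
  have l : TERM[0, a, g', j] = ∑ W : Finset κ, wt[g', W] * (if j + 1 ≤ ∑ k ∈ W, a k then (1 : ℝ) else 0) :=
    Finset.sum_congr rfl fun W _ => by rw [zero_add]
  have r : TERM[0, a, g, j] = ∑ W : Finset κ, wt[g, W] * (if j + 1 ≤ ∑ k ∈ W, a k then (1 : ℝ) else 0) :=
    Finset.sum_congr rfl fun W _ => by rw [zero_add]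
  rw [← l, ← r, e]

end RootDec

namespace IndepBlob

open Finset

/-- **CONJECTURE — the floor-split step lemma on the LUMPY CORE** (lead g18): `StepLemmaFSCore` with three more hypotheses — EMPTY blobs are
sure (`a k = 0 → g k = 1`, a normalisation: `RootDec.term_congr_offEmpty`), at least THREE pairwise distinct non-empty light blobs (two lights
are kernel: p1 g12 `dibStar_of_twoLights`), and the system is NOT granular (`∃ k, j < 2x·a k`; granular systems are kernel: lead g18
`tail_ge_of_granular`).  Equivalent to `∀ x < 1, DIBStar x` (`stepLemmaFSLumpy_iff_dibStar`).  builds on p205010 (kernel theorem, internal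
audit signed; external expert review pending). [this work] [status: open] -/
@[conjecture] def StepLemmaFSLumpy : Prop :=
  ∀ (κ : Type) [Fintype κ] [DecidableEq κ] (a : κ → ℕ) (g : κ → ℝ) (j : ℕ) (x : ℝ),
    1 / 2 < x → x < 1 →
    (∀ k, 0 ≤ g k ∧ g k ≤ 1) →
    (∀ k, g k < x → a k ≤ j) →
    (∑ k ∈ Finset.univ.filter (fun k => x ≤ g k), a k ≤ 2 * j) →
    (∀ k, x ≤ g k → a k ≤ j) →
    (∃ k₁ k₂ k₃, k₁ ≠ k₂ ∧ k₁ ≠ k₃ ∧ k₂ ≠ k₃ ∧ g k₁ < x ∧ 0 < a k₁ ∧ g k₂ < x ∧ 0 < a k₂ ∧ g k₃ < x ∧ 0 < a k₃) →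
    (j + 1 ≤ ∑ k ∈ Finset.univ.filter (fun k => g k < x), a k) →
    (∀ k, g k < x → 0 < a k → x ^ 2 < g k) →
    (∀ k, (∀ i, a i ≤ a k) → g k < 1) →
    (∀ k, a k = 0 → g k = 1) →
    (∃ k, (j : ℝ) < 2 * x * a k) →
    (2 * j : ℝ) < ∑ k, (a k : ℝ) * (if x ≤ g k then g k else (g k - x ^ 2) / (1 - x)) →
    (∀ k, 0 < a k → RootDec.CappedRows (Function.update a k 0) g) →
    x ≤ ∑ W : Finset κ, (∏ k, if k ∈ W then g k else 1 - g k) * (if j + 1 ≤ ∑ k ∈ W, a k then (1 : ℝ) else 0)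

/-- The lumpy step lemma follows from DIB\* below one. [this work] -/
theorem stepLemmaFSLumpy_of_dibStar (h : ∀ x : ℝ, x < 1 → DIBStar x) : StepLemmaFSLumpy :=
  fun κ _ _ a g j x _ hx1 hg hlight _ _ _ _ _ _ _ _ hcredit _ => h x hx1 κ a g j hg hlight hcredit

end IndepBlob

namespace RootDec

open Finset

variable {κ : Type*} [Fintype κ] [DecidableEq κ]

/-- product-Bernoulli weight of the set `W` of open blobs (as in `…QuantRootReduction`) -/
local notation3 "wt[" g ", " W "]" => ∏ k, (if k ∈ (W : Finset κ) then (g : κ → ℝ) k else 1 - (g : κ → ℝ) k)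

/-- the TERM tail `P(s + Σ_{k open} a k ≥ j+1)` (as in `…QuantRootReduction`) -/
local notation3 "TERM[" s ", " a ", " g ", " j "]" =>
  ∑ W : Finset κ, wt[g, W] * (if (j : ℕ) + 1 ≤ (s : ℕ) + ∑ k ∈ W, (a : κ → ℕ) k then (1 : ℝ) else 0)

/-- **THE CORE STEP from the LUMPY STEP.**  Given `StepLemmaFSLumpy`, every instance of `StepLemmaFSCore`'s hypothesis block is decided:
normalise empty blobs to gate `1` (`term_congr_offEmpty`), then either the system is granular (`IndepBlob.tail_ge_of_granular`), or it has exactly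
two non-empty lights (`IndepBlob.dibStar_of_twoLights`), or it is lumpy with three lights (the hypothesis). [this work] -/
theorem stepLemmaFSCore_of_lumpy (H : IndepBlob.StepLemmaFSLumpy) : IndepBlob.StepLemmaFSCore := by
  intro κ _ _ a g j x hx hx1 hg hlight hcorner hnogiant htwo hbig hpos hcore hcredit hIH
  have hx0 : 0 < x := by linarith
  obtain ⟨ℓ₁, ℓ₂, hne, hℓ₁, hℓ₁a, hℓ₂, hℓ₂a⟩ := htwo
  -- normalise the empty blobs to gate `1`
  obtain ⟨g', hg'def⟩ : ∃ g' : κ → ℝ, g' = fun k => if a k = 0 then (1 : ℝ) else g k := ⟨_, rfl⟩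
  have hg'ne : ∀ k, a k ≠ 0 → g' k = g k := fun k hk => by simp [hg'def, hk]
  have hg'e : ∀ k, a k = 0 → g' k = 1 := fun k hk => by simp [hg'def, hk]
  have hgg' : ∀ k, 0 ≤ g' k ∧ g' k ≤ 1 := by
    intro k; by_cases hk : a k = 0
    · rw [hg'e k hk]; norm_num
    · rw [hg'ne k hk]; exact hg k
  -- a light of `g'` is a non-empty light of `g`
  have hlt : ∀ k, g' k < x → g k < x ∧ 0 < a k := by
    intro k hk
    by_cases h0 : a k = 0
    · rw [hg'e k h0] at hk; linarith
    · rw [hg'ne k h0] at hk; exact ⟨hk, Nat.pos_of_ne_zero h0⟩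
  have hge : ∀ k, x ≤ g' k → x ≤ g k ∨ a k = 0 := by
    intro k hk
    by_cases h0 : a k = 0
    · exact Or.inr h0
    · rw [hg'ne k h0] at hk; exact Or.inl hk
  -- the conclusion is invariant under the normalisation
  rw [← dibSum_congr_offEmpty a g g' j hg'ne]
  -- the hypotheses for `g'`
  have hlight' : ∀ k, g' k < x → a k ≤ j := fun k hk => hlight k (hlt k hk).1
  have hfilt_heavy : ∑ k ∈ Finset.univ.filter (fun k => x ≤ g' k), a k = ∑ k ∈ Finset.univ.filter (fun k => x ≤ g k), a k := by
    rw [Finset.sum_filter, Finset.sum_filter]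
    refine Finset.sum_congr rfl fun k _ => ?_
    by_cases h0 : a k = 0
    · simp [h0]
    · rw [hg'ne k h0]
  have hcorner' : ∑ k ∈ Finset.univ.filter (fun k => x ≤ g' k), a k ≤ 2 * j := by rw [hfilt_heavy]; exact hcorner
  have hnogiant' : ∀ k, x ≤ g' k → a k ≤ j := by
    intro k hk
    rcases hge k hk with h | h
    · exact hnogiant k h
    · rw [h]; exact Nat.zero_le _
  have hfilt_light : ∑ k ∈ Finset.univ.filter (fun k => g' k < x), a k = ∑ k ∈ Finset.univ.filter (fun k => g k < x), a k := by
    rw [Finset.sum_filter, Finset.sum_filter]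
    refine Finset.sum_congr rfl fun k _ => ?_
    by_cases h0 : a k = 0
    · simp [h0]
    · rw [hg'ne k h0]
  have hbig' : j + 1 ≤ ∑ k ∈ Finset.univ.filter (fun k => g' k < x), a k := by rw [hfilt_light]; exact hbig
  have hpos' : ∀ k, g' k < x → 0 < a k → x ^ 2 < g' k := by
    intro k hk hak
    rw [hg'ne k (Nat.pos_iff_ne_zero.1 hak)]
    exact hpos k (hlt k hk).1 hak
  have hcore' : ∀ k, (∀ i, a i ≤ a k) → g' k < 1 := by
    intro k hmax
    have hk : a k ≠ 0 := by
      intro h0; have := hmax ℓ₁; omega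
    rw [hg'ne k hk]; exact hcore k hmax
  have hcredit' : (2 * j : ℝ) < ∑ k, (a k : ℝ) * (if x ≤ g' k then g' k else (g' k - x ^ 2) / (1 - x)) := by
    refine hcredit.trans_le (le_of_eq (Finset.sum_congr rfl fun k _ => ?_))
    by_cases h0 : a k = 0
    · simp [h0]
    · rw [hg'ne k h0]
  -- the inductive rows transfer to `g'` (the deleted systems have the same non-empty blobs minus `k`; TERM tails and capped
  -- credits do not see the gates of empty blobs)
  have hIH' : ∀ k, 0 < a k → CappedRows (Function.update a k 0) g' := by
    intro k hk z s' j' hz1 hbudget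
    have hoff : ∀ i, Function.update a k 0 i ≠ 0 → g' i = g i := by
      intro i hi
      have hik : i ≠ k := by rintro rfl; simp at hi
      rw [Function.update_of_ne hik] at hi
      exact hg'ne i hi
    have row := hIH k hk z s' j' hz1 ?_
    · exact row.trans_eq (term_congr_offEmpty s' (Function.update a k 0) g g' j' hoff).symm
    · refine hbudget.trans_le (le_of_eq (congrArg _ (Finset.sum_congr rfl fun i _ => ?_)))
      by_cases hi : Function.update a k 0 i = 0
      · rw [hi]; split_ifs <;> simp
      · rw [hoff i hi]
  -- dispatch
  by_cases hgran : ∀ k, 2 * x * (a k : ℝ) ≤ j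
  · exact IndepBlob.tail_ge_of_granular x hx0.le hx1 a g' j hgg' hgran hcredit'
  push Not at hgran
  by_cases hthree : ∃ k₃, k₃ ≠ ℓ₁ ∧ k₃ ≠ ℓ₂ ∧ g k₃ < x ∧ 0 < a k₃
  · obtain ⟨k₃, h31, h32, hk₃, hk₃a⟩ := hthree
    have hℓ₁' : g' ℓ₁ < x := by rw [hg'ne ℓ₁ (by omega)]; exact hℓ₁
    have hℓ₂' : g' ℓ₂ < x := by rw [hg'ne ℓ₂ (by omega)]; exact hℓ₂
    have hk₃' : g' k₃ < x := by rw [hg'ne k₃ (by omega)]; exact hk₃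
    exact H κ a g' j x hx hx1 hgg' hlight' hcorner' hnogiant'
      ⟨ℓ₁, ℓ₂, k₃, hne, h31.symm, h32.symm, hℓ₁', hℓ₁a, hℓ₂', hℓ₂a, hk₃', hk₃a⟩ hbig' hpos' hcore' hg'e hgran hcredit' hIH'
  · -- exactly two non-empty lights: p1 g12's theorem for `g'`
    push Not at hthree
    have hheavy : ∀ k, k ≠ ℓ₁ → k ≠ ℓ₂ → x ≤ g' k := by
      intro k h1 h2
      by_contra hlt'
      have hh := hlt k (not_le.1 hlt')
      have := hthree k h1 h2 hh.1
      omega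
    have hℓ₁' : g' ℓ₁ = g ℓ₁ := hg'ne ℓ₁ (by omega)
    have hℓ₂' : g' ℓ₂ = g ℓ₂ := hg'ne ℓ₂ (by omega)
    exact IndepBlob.dibStar_of_twoLights x hx hx1 a g' j hgg' ℓ₁ ℓ₂ hne
      ⟨by rw [hℓ₁']; exact (hpos ℓ₁ hℓ₁ hℓ₁a).le, by rw [hℓ₁']; exact hℓ₁⟩
      ⟨by rw [hℓ₂']; exact (hpos ℓ₂ hℓ₂ hℓ₂a).le, by rw [hℓ₂']; exact hℓ₂⟩ hheavy
      ⟨hℓ₁a, hlight ℓ₁ hℓ₁⟩ ⟨hℓ₂a, hlight ℓ₂ hℓ₂⟩ hcredit'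

/-- **`StepLemmaFSLumpy ⟹` the capped row of every finite system** (through the core induction). [this work] -/
theorem cappedRows_of_stepLemmaFSLumpy (H : IndepBlob.StepLemmaFSLumpy) {κ : Type} [Fintype κ] [DecidableEq κ] (a : κ → ℕ)
    (g : κ → ℝ) (hg : ∀ k, 0 ≤ g k ∧ g k ≤ 1) : CappedRows a g :=
  cappedRows_of_stepLemmaFSCore (stepLemmaFSCore_of_lumpy H) a g hg

end RootDec

namespace IndepBlob

/-- **`StepLemmaFSLumpy ⟹ DIB\*` at every floor `x < 1`.** [this work] -/
theorem dibStar_of_stepLemmaFSLumpy (H : StepLemmaFSLumpy) (x : ℝ) (hx1 : x < 1) : DIBStar x :=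
  dibStar_of_stepLemmaFSCore (RootDec.stepLemmaFSCore_of_lumpy H) x hx1

/-- **T-DIB ≡ the LUMPY step lemma**: `StepLemmaFSLumpy ↔ ∀ x < 1, DIBStar x`. [this work] -/
theorem stepLemmaFSLumpy_iff_dibStar : StepLemmaFSLumpy ↔ ∀ x : ℝ, x < 1 → DIBStar x :=
  ⟨fun H x hx => dibStar_of_stepLemmaFSLumpy H x hx, stepLemmaFSLumpy_of_dibStar⟩

end IndepBlob

end Quant

end Summit.CriticalPhenomena.PercolationContinuityZ3.Theorems
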